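import Literature.NumberTheory.LFunctions.MatomakiRadziwillTaoT2OfVK
import Literature.NumberTheory.LFunctions.VinogradovZetaSumEstimate
import HarnessLib

/-!
# parity.S21 holds: Tao's logarithmically averaged two-point Chowla for `λ` and `μ` (discharges)

Topic `Literature/NumberTheory/Sieve`.  Everything in this file is PROVED; no definitions, no named facts.

DISCHARGE of the two named facts of `ParityWave0.lean`
* `Literature.NumberTheory.Sieve.tao_log_chowla_moebius` — `∑_{n ≤ x} μ(n) μ(n+h)/n = o(log x)` for every
  `h ≥ 1` (T. Tao, *The logarithmically averaged Chowla and Elliott conjectures for two-point correlations*,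
  Forum Math. Pi 4 (2016), e8, §1, the display after Remark 1.6: "Corollary 1.5 also implies
  `∑_{n ≤ x} g₁(n) g₂(n+1)/n = o(log x)` when … one of them is `μ`; thus `∑ μ(n)μ(n+1)/n = o(log x)`"), and
* `Literature.NumberTheory.Sieve.tao_log_chowla_liouville` — the same for `λ` (op. cit., Theorem 1.2 / (1.4)),

as `tao_log_chowla_moebius_holds` and `tao_log_chowla_liouville_holds`, unconditionally.  The proof is the
tree's formalisation of the whole published chain, now closed:

1. Vinogradov's mean value theorem (Ivić, *The Riemann Zeta-Function*, Lemmas 6.1–6.3; `VinogradovMeanValue*.lean`);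
2. Vinogradov's zeta-sum estimate (Ivić, Thm 6.2), van der Corput in the complementary range, Richert-type bounds for
   `ζ` and `L(s, χ)`, Landau's deduction — the Vinogradov–Korobov zero-free region for Dirichlet `L`-functions,
   unconditionally: `LFunctions.VKZeta.exists_hasVKZeroFreeRegion` (`VinogradovZetaSumEstimate.lean`),
   `∃ c > 0, HasVKZeroFreeRegion c 21` (independently also `LFunctions.VinogradovZetaSum.hasVKZeroFreeRegion_of_vmvtBound`
   with `LFunctions.exists_vmvtBound`);
3. Halász's theorem, Granville–Soundararajan, Matomäki–Radziwiłł §8 for the `𝒮`-restricted polynomial of a complex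
   `f`, Matomäki–Radziwiłł–Tao Appendix A (Prop. A.3 with middle term `(1+M)e^{-M/2}`, Thm A.2), the major and
   minor arcs of MRT Prop. 2.4, MRT Thm 1.7, Tao's Thm 2.3, Prop. 2.4, Thm 1.3, Cor. 1.5 and the deductions for
   `λ`, `μ` — `LFunctions.MRT2015.tao_log_chowla_moebius_of_vk`, `LFunctions.MRT2015.tao_log_chowla_liouville_of_vk`
   (`MatomakiRadziwillTaoT2OfVK.lean`, from any region `HasVKZeroFreeRegion c T₀`, `c > 0`).

## References
* T. Tao, Forum Math. Pi 4 (2016), e8, doi:10.1017/fmp.2016.6 (arXiv:1509.05422): Theorem 1.2, Corollary 1.5 and §1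
  after Remark 1.6. [cite: TaoFMP2016, Theorem 1.2] [cite: TaoFMP2016, §1 after Remark 1.6]
* K. Matomäki, M. Radziwiłł, T. Tao, Algebra & Number Theory 9 (2015), Theorem 1.7 and Appendix A.
  [cite: MatomakiRadziwillTao2015, Appendix A]
* A. Ivić, *The Riemann Zeta-Function* (1985), Lemma 6.3 and Theorem 6.2. [cite: Ivic1985, Theorem 6.2]
-/

noncomputable section

namespace Literature.NumberTheory.Sieve

open LFunctions

/-- **DISCHARGE of `tao_log_chowla_moebius`** (parity.S21 for Möbius; Tao 2016, §1 after Remark 1.6: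
`∑_{n ≤ x} μ(n)μ(n+h)/n = o(log x)`, `h ≥ 1`): the Vinogradov–Korobov region
(`VKZeta.exists_hasVKZeroFreeRegion`) fed into `MRT2015.tao_log_chowla_moebius_of_vk`.
[cite: TaoFMP2016, §1 after Remark 1.6] -/
theorem tao_log_chowla_moebius_holds : tao_log_chowla_moebius := by
  obtain ⟨c, hc, hVK⟩ := VKZeta.exists_hasVKZeroFreeRegion
  exact MRT2015.tao_log_chowla_moebius_of_vk hc hVK

/-- **DISCHARGE of `tao_log_chowla_liouville`** (parity.S21 for Liouville; Tao 2016, Theorem 1.2 (1.4) with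
`ω = x`: `∑_{n ≤ x} λ(n)λ(n+h)/n = o(log x)`, `h ≥ 1`): the Vinogradov–Korobov region fed into
`MRT2015.tao_log_chowla_liouville_of_vk`. [cite: TaoFMP2016, Theorem 1.2] -/
theorem tao_log_chowla_liouville_holds : tao_log_chowla_liouville := by
  obtain ⟨c, hc, hVK⟩ := VKZeta.exists_hasVKZeroFreeRegion
  exact MRT2015.tao_log_chowla_liouville_of_vk hc hVK

end Literature.NumberTheory.Sieve
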